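import Literature.NumberTheory.Sieve.SingularSeries
import Mathlib.Data.ZMod.Basic
import Mathlib.Data.Complex.Basic
import HarnessLib

/-!
# Tao–Teräväinen 2022, §8 (`k = 2`): the singular series of a pair and its Euler factors `β_p`

Topic `Literature/Barriers/Parity`, sub-namespace `TaoTeravainen`; bookkeeping for the identification of
the constant `𝔖` in Proposition 8.1 of T. Tao, J. Teräväinen, *The Hardy–Littlewood–Chowla conjecture in
the presence of a Siegel zero*, J. London Math. Soc. (2) 106 (2022), arXiv:2109.06291, §8 ("we see from
(1.3) that `∏_p β_p = 𝔖`", where `β_p = (1 - m_p/p)(1 - 1/p)^{-2}` and `m_p` is the number of residues of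
`h₁, h₂` modulo `p`), with the tree's `Literature.NumberTheory.Sieve.singularSeriesFactor`,
`singularSeriesPartial`, `singularSeries`. Everything here is PROVED:

* `tupleResidueCount_pair` — `ν_{{a,b}}(p) = 1` if `p ∣ a − b`, else `2`;
* `singularSeriesFactor_pair_eq` / `singularSeriesFactor_pair_complex` — `β_p` in closed form, real and
  complex: `(1 − 1/p)·((1−1/p)⁻¹)²` resp. `(1 − 2/p)·((1−1/p)⁻¹)²` (the model factor of
  `SiegelZeroDichotomyPairHLMainTermLocal.localE_sub_model_eq`);
* `singularSeriesPartial_eq_prod_primesBelow` — `∏_{p ≤ N−1} = ∏_{p < N}`.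
  [cite: TaoTeravainen2021, §1 (1.3) and §8 ("`∏_p β_p = 𝔖`")]
-/

noncomputable section

open Finset

namespace Literature.Barriers.Parity

namespace TaoTeravainen

open Literature.NumberTheory.Sieve

/-- **`ν_{{a,b}}(p)`**: the pair `{a, b}` occupies one residue class modulo `p` if `p ∣ a − b` and two
otherwise. [cite: TaoTeravainen2021, §8 ("`m` the number of residues of `h₁, h₂` modulo `p`")] -/
theorem tupleResidueCount_pair (a b : ℤ) (p : ℕ) :
    tupleResidueCount ({a, b} : Finset ℤ) p = if (p : ℤ) ∣ a - b then 1 else 2 := by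
  unfold tupleResidueCount
  rw [image_insert, image_singleton]
  by_cases h : (p : ℤ) ∣ a - b
  · rw [if_pos h]
    have hab : ((a : ℤ) : ZMod p) = ((b : ℤ) : ZMod p) := by
      rw [ZMod.intCast_eq_intCast_iff_dvd_sub]
      rwa [dvd_sub_comm]
    rw [hab, insert_eq_of_mem (mem_singleton_self _), card_singleton]
  · rw [if_neg h]
    have hab : ((a : ℤ) : ZMod p) ≠ ((b : ℤ) : ZMod p) := by
      rw [Ne, ZMod.intCast_eq_intCast_iff_dvd_sub, dvd_sub_comm]
      exact h
    rw [card_insert_of_notMem (by simpa using hab), card_singleton]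

/-- **`β_p` in closed form** (`a ≠ b`, any `p`):
`singularSeriesFactor {a,b} p = (1 − ν/p)((1 − 1/p)⁻¹)²` with `ν = 1` or `2`. [cite: TaoTeravainen2021, §1 (1.3)] -/
theorem singularSeriesFactor_pair_eq {a b : ℤ} (hab : a ≠ b) (p : ℕ) :
    singularSeriesFactor ({a, b} : Finset ℤ) p =
      if (p : ℤ) ∣ a - b then (1 - 1 / (p : ℝ)) * ((1 - 1 / (p : ℝ))⁻¹) ^ 2
      else (1 - 2 / (p : ℝ)) * ((1 - 1 / (p : ℝ))⁻¹) ^ 2 := by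
  unfold singularSeriesFactor
  rw [tupleResidueCount_pair, card_pair hab]
  split_ifs <;> push_cast <;> ring

/-- The same as complex numbers (the model factor `β_p` of the main-term files).
[cite: TaoTeravainen2021, §8 ("`∏_p β_p = 𝔖`")] -/
theorem singularSeriesFactor_pair_complex {a b : ℤ} (hab : a ≠ b) (p : ℕ) :
    ((singularSeriesFactor ({a, b} : Finset ℤ) p : ℝ) : ℂ) =
      if (p : ℤ) ∣ a - b then (1 - 1 / (p : ℂ)) * ((1 - 1 / (p : ℂ))⁻¹) ^ 2
      else (1 - 2 / (p : ℂ)) * ((1 - 1 / (p : ℂ))⁻¹) ^ 2 := by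
  rw [singularSeriesFactor_pair_eq hab]
  split_ifs <;> push_cast <;> rfl

/-- `∏_{p ≤ N−1} factor(p) = ∏_{p < N} factor(p)` (`N ≥ 1`). [folklore] -/
theorem singularSeriesPartial_eq_prod_primesBelow (H : Finset ℤ) {N : ℕ} (hN : 1 ≤ N) :
    singularSeriesPartial H (N - 1) = ∏ p ∈ Nat.primesBelow N, singularSeriesFactor H p := by
  unfold singularSeriesPartial Nat.primesLE
  rw [Nat.sub_add_cancel hN]

end TaoTeravainen

end Literature.Barriers.Parity
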